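import Summits.Ventures.CertifiedArithmetic.LowPrec.GemmThetaLawMixAFamilyWord
import Summits.Ventures.CertifiedArithmetic.LowPrec.GemmTwoBinadeClimb
import HarnessLib

/-!
# GEMM worst case LIII-b — the canonical E2M3·E2M1 family for EVERY precision `p ≥ 8`: an
# explicit all-`n` input whose sequential-RNE relative error is `1 - 30θ_p/(30n - 28482K + 3)`

HONEST FRAMING: certified error envelopes and provably optimal rounding/accumulation schemes for
low-precision formats under stated cost models; every table by two implementations; no hardware or
vendor claims.

The UPPER side of the mixed E2M3·E2M1 θ-law (gemm.tex Thm. `t:thetapmix`, first row of the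
mixed all-precision laws), symbolically in the precision.  For a target format `φ` with the grid
`2^-4` in range (`qexp φ ≤ -4`) and `2^(manBits φ + 12) ≤ maxRat φ` (bfloat16, binary32,
binary64, …), and `2^manBits = 128K` (`K = 2^(p-8)`), the family `fam4 K` of file LIII-a
(`GemmThetaLawMixAFamilyWord`; every letter a product of an E2M3 and an E2M1 datum, `fam4_mem`)
has the explicit piecewise-affine accumulator trajectory `traj4 K` (`fam4_seqSum`): the `K`
letters `16` are summed EXACTLY up to `2·2^manBits` grid units, every `3/16` is `spacing + tie`
resolved up, in binade `j = 1..8` each letter of the pair `(x_j, 2^j)/16` advances the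
accumulator by exactly one grid step (the first exceeds the half-spacing from an even point, the
second is a tie from an odd point resolved up — ties-to-even), the end letter `33` rounds up to
`v° = (128K+1)·64`, and every later `-30` is absorbed (`fam4_tail`).  Prefix `1089K + 1`
letters, mass `(67008K + 528)/16`; hence (`fam4_relErr`) for every `n ≥ 1089K + 1` letters the
relative error is EXACTLY `(30n - 28666K + 1)/(30n - 28482K + 3) = 1 - (184K + 2)/(30n -
28482K + 3)`, and `184K + 2 = 30·θ_p` with `θ_p = (23·2^manBits + 32)/480 =
e2m3e2m1Law.thetaL manBits` (`fam4_defect`).  File LIV (`GemmWorstCaseMixAPrec`) turns this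
into the upper half of the two-sided sandwich for `W_p(n)` over the mixed alphabet and the limit
`n(1 - W_p(n)) → θ_p` for every `p ≥ 10`.

Method (no `decide` over trajectories — the precision is a symbol): the binade-step lemma
`rneSigMag_binade_step` (file XLIX-a) and the grid bridge `value_step4` (file LIII-a), a
twelve-way case analysis of the letter index closed by `omega` (`traj4_step`), then the landed
tie-chain assembly `tieChain_spec` / `tieChain_inRange` for the absorbed tail.  At `p = 8`
(`K = 1`) this is the certified `bfloat16` family of Prop. `p:theta`(ii) (`m = 1090`); the onset
`1089K + 1 = 17·2^(p-2) + 2^(p-8) + 1` is the paper's `m_p` for `p ≥ 8`.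

References: the law and its SUP side for every `p ≥ 10` are `thetaCert_e2m3e2m1Law`
(`GemmThetaLawGenFinal`); explicit worst-case inputs for recursive summation in the literature
are format-by-format ([Higham2002, §4.2], [MullerEtAl2018HFPA, §6.1]; formal FP error analysis
per format in Flocq [BoldoMelquiond2011Flocq]); FP6/FP4 values [RouhaniEtAl2023MX, Table 1].
-/

namespace Summit.Ventures.CertifiedArithmetic.LowPrec.Gemm

open Literature.ComputerArithmetic.FloatingPoint
open Literature.ComputerArithmetic.FloatingPoint.MiniFloat
open Literature.ComputerArithmetic.FloatingPoint.MiniFloat.TieChain (seqSum_orbitFn)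
open Finset

variable {φ : Format}

section Steps

variable (hq : φ.qexp ≤ -4) (hR : (2 : ℚ) ^ (φ.manBits + 12) ≤ φ.maxRat)
  {K : ℕ} (hM : 2 ^ φ.manBits = 128 * K)
include hq hR hM

/-- THE PREFIX ROUNDINGS (twelve cases of the letter index, each one binade step):
`fl_φ(traj4 k + fam4 (k+1)) = traj4 (k+1)` for every `k < 1089K`, and the step is in range.
[cell] -/
theorem traj4_step (k : ℕ) (hk : k < 1089 * K) :
    (roundNE φ (traj4 K k + fam4 K (k + 1))).toRat = traj4 K (k + 1) ∧
      |traj4 K k + fam4 K (k + 1)| ≤ φ.maxRat := by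
  obtain ⟨hK1, hpow, hpow1⟩ := pow_facts4 hM
  have h2 : 2 ∣ 128 * K := ⟨64 * K, by ring⟩
  unfold traj4 fam4
  rcases (by omega : k + 2 < K ∨ k + 2 = K ∨ (K ≤ k + 1 ∧ k + 2 ≤ 65 * K) ∨
      (65 * K ≤ k + 1 ∧ k + 2 ≤ 193 * K) ∨ (193 * K ≤ k + 1 ∧ k + 2 ≤ 321 * K) ∨
      (321 * K ≤ k + 1 ∧ k + 2 ≤ 449 * K) ∨ (449 * K ≤ k + 1 ∧ k + 2 ≤ 577 * K) ∨
      (577 * K ≤ k + 1 ∧ k + 2 ≤ 705 * K) ∨ (705 * K ≤ k + 1 ∧ k + 2 ≤ 833 * K) ∨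
      (833 * K ≤ k + 1 ∧ k + 2 ≤ 961 * K) ∨ (961 * K ≤ k + 1 ∧ k + 2 ≤ 1089 * K) ∨
      k + 1 = 1089 * K) with
      h | h | h | h | h | h | h | h | h | h | h | h
  · -- exact prefix: `256(k+2) < 256K = 2^(m+1)`
    refine value_step4 hq hR (n := 256 * k + 512) ?_ (by omega) ?_
    · rw [traj4N_P (by omega), fam4Z_P (by omega)]; push_cast; omega
    · rw [traj4N_P (by omega), rneSigMag_of_lt (by rw [hpow1]; omega)]; omega
  · -- the last `16` lands exactly on `2^(m+1) = (128K + 0)·2 + 0` (binade 0, `r = 0`)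
    refine value_step4 hq hR (n := (128 * K + 0) * 2 + 0) ?_ (by omega) ?_
    · rw [traj4N_P (by omega), fam4Z_P (by omega)]; push_cast; omega
    · rw [traj4N_P (by omega), rneSigMag_binade_step (j := 0) hM h2 (by norm_num) (by omega)
        (by norm_num)]
      simp [stepUp]; omega
  · -- binade 0, letter `3 = spacing + 1` from an even point: a tie at an odd `t`, resolved up
    refine value_step4 hq hR (n := (128 * K + (2 * k + 3 - 2 * K)) * 2 + 1) ?_ (by omega) ?_
    · rw [traj4N_B0 (by omega) (by omega), fam4Z_B0 (by omega) (by omega)]; push_cast; omega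
    · rw [traj4N_B0 (by omega) (by omega), rneSigMag_binade_step (j := 0) hM h2 (by norm_num)
        (by omega) (by norm_num)]
      simp [stepUp]; omega
  · -- binade 1: `(3, 2)` pairs (grid units), spacing `4`
    obtain ⟨e, he, hek⟩ : ∃ e, e < 128 * K ∧ k + 1 = 65 * K + e :=
      ⟨k + 1 - 65 * K, by omega, by omega⟩
    rcases Nat.mod_two_eq_zero_or_one e with hp | hp
    · refine value_step4 hq hR (n := (128 * K + e) * 4 + 3) ?_ (by omega) ?_
      · rw [traj4N_T1 (by omega) (by omega), hek, fam4Z_B1 K e he, pairZ_even _ _ hp]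
        push_cast; omega
      · rw [traj4N_T1 (by omega) (by omega), rneSigMag_binade_step (j := 1) hM h2 (by norm_num)
          (by omega) (by norm_num)]
        simp [stepUp]; omega
    · refine value_step4 hq hR (n := (128 * K + e) * 4 + 2) ?_ (by omega) ?_
      · rw [traj4N_T1 (by omega) (by omega), hek, fam4Z_B1 K e he, pairZ_odd _ _ hp]
        push_cast; omega
      · rw [traj4N_T1 (by omega) (by omega), rneSigMag_binade_step (j := 1) hM h2 (by norm_num)
          (by omega) (by norm_num)]
        simp [stepUp]; omega
  · -- binade 2: `(5, 4)` pairs (grid units), spacing `8`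
    obtain ⟨e, he, hek⟩ : ∃ e, e < 128 * K ∧ k + 1 = 193 * K + e :=
      ⟨k + 1 - 193 * K, by omega, by omega⟩
    rcases Nat.mod_two_eq_zero_or_one e with hp | hp
    · refine value_step4 hq hR (n := (128 * K + e) * 8 + 5) ?_ (by omega) ?_
      · rw [traj4N_T2 (by omega) (by omega), hek, fam4Z_B2 K e he, pairZ_even _ _ hp]
        push_cast; omega
      · rw [traj4N_T2 (by omega) (by omega), rneSigMag_binade_step (j := 2) hM h2 (by norm_num)
          (by omega) (by norm_num)]
        simp [stepUp]; omega
    · refine value_step4 hq hR (n := (128 * K + e) * 8 + 4) ?_ (by omega) ?_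
      · rw [traj4N_T2 (by omega) (by omega), hek, fam4Z_B2 K e he, pairZ_odd _ _ hp]
        push_cast; omega
      · rw [traj4N_T2 (by omega) (by omega), rneSigMag_binade_step (j := 2) hM h2 (by norm_num)
          (by omega) (by norm_num)]
        simp [stepUp]; omega
  · -- binade 3: `(9, 8)` pairs (grid units), spacing `16`
    obtain ⟨e, he, hek⟩ : ∃ e, e < 128 * K ∧ k + 1 = 321 * K + e :=
      ⟨k + 1 - 321 * K, by omega, by omega⟩
    rcases Nat.mod_two_eq_zero_or_one e with hp | hp
    · refine value_step4 hq hR (n := (128 * K + e) * 16 + 9) ?_ (by omega) ?_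
      · rw [traj4N_T3 (by omega) (by omega), hek, fam4Z_B3 K e he, pairZ_even _ _ hp]
        push_cast; omega
      · rw [traj4N_T3 (by omega) (by omega), rneSigMag_binade_step (j := 3) hM h2 (by norm_num)
          (by omega) (by norm_num)]
        simp [stepUp]; omega
    · refine value_step4 hq hR (n := (128 * K + e) * 16 + 8) ?_ (by omega) ?_
      · rw [traj4N_T3 (by omega) (by omega), hek, fam4Z_B3 K e he, pairZ_odd _ _ hp]
        push_cast; omega
      · rw [traj4N_T3 (by omega) (by omega), rneSigMag_binade_step (j := 3) hM h2 (by norm_num)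
          (by omega) (by norm_num)]
        simp [stepUp]; omega
  · -- binade 4: `(18, 16)` pairs (grid units), spacing `32`
    obtain ⟨e, he, hek⟩ : ∃ e, e < 128 * K ∧ k + 1 = 449 * K + e :=
      ⟨k + 1 - 449 * K, by omega, by omega⟩
    rcases Nat.mod_two_eq_zero_or_one e with hp | hp
    · refine value_step4 hq hR (n := (128 * K + e) * 32 + 18) ?_ (by omega) ?_
      · rw [traj4N_T4 (by omega) (by omega), hek, fam4Z_B4 K e he, pairZ_even _ _ hp]
        push_cast; omega
      · rw [traj4N_T4 (by omega) (by omega), rneSigMag_binade_step (j := 4) hM h2 (by norm_num)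
          (by omega) (by norm_num)]
        simp [stepUp]; omega
    · refine value_step4 hq hR (n := (128 * K + e) * 32 + 16) ?_ (by omega) ?_
      · rw [traj4N_T4 (by omega) (by omega), hek, fam4Z_B4 K e he, pairZ_odd _ _ hp]
        push_cast; omega
      · rw [traj4N_T4 (by omega) (by omega), rneSigMag_binade_step (j := 4) hM h2 (by norm_num)
          (by omega) (by norm_num)]
        simp [stepUp]; omega
  · -- binade 5: `(33, 32)` pairs (grid units), spacing `64`
    obtain ⟨e, he, hek⟩ : ∃ e, e < 128 * K ∧ k + 1 = 577 * K + e :=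
      ⟨k + 1 - 577 * K, by omega, by omega⟩
    rcases Nat.mod_two_eq_zero_or_one e with hp | hp
    · refine value_step4 hq hR (n := (128 * K + e) * 64 + 33) ?_ (by omega) ?_
      · rw [traj4N_T5 (by omega) (by omega), hek, fam4Z_B5 K e he, pairZ_even _ _ hp]
        push_cast; omega
      · rw [traj4N_T5 (by omega) (by omega), rneSigMag_binade_step (j := 5) hM h2 (by norm_num)
          (by omega) (by norm_num)]
        simp [stepUp]; omega
    · refine value_step4 hq hR (n := (128 * K + e) * 64 + 32) ?_ (by omega) ?_
      · rw [traj4N_T5 (by omega) (by omega), hek, fam4Z_B5 K e he, pairZ_odd _ _ hp]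
        push_cast; omega
      · rw [traj4N_T5 (by omega) (by omega), rneSigMag_binade_step (j := 5) hM h2 (by norm_num)
          (by omega) (by norm_num)]
        simp [stepUp]; omega
  · -- binade 6: `(66, 64)` pairs (grid units), spacing `128`
    obtain ⟨e, he, hek⟩ : ∃ e, e < 128 * K ∧ k + 1 = 705 * K + e :=
      ⟨k + 1 - 705 * K, by omega, by omega⟩
    rcases Nat.mod_two_eq_zero_or_one e with hp | hp
    · refine value_step4 hq hR (n := (128 * K + e) * 128 + 66) ?_ (by omega) ?_
      · rw [traj4N_T6 (by omega) (by omega), hek, fam4Z_B6 K e he, pairZ_even _ _ hp]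
        push_cast; omega
      · rw [traj4N_T6 (by omega) (by omega), rneSigMag_binade_step (j := 6) hM h2 (by norm_num)
          (by omega) (by norm_num)]
        simp [stepUp]; omega
    · refine value_step4 hq hR (n := (128 * K + e) * 128 + 64) ?_ (by omega) ?_
      · rw [traj4N_T6 (by omega) (by omega), hek, fam4Z_B6 K e he, pairZ_odd _ _ hp]
        push_cast; omega
      · rw [traj4N_T6 (by omega) (by omega), rneSigMag_binade_step (j := 6) hM h2 (by norm_num)
          (by omega) (by norm_num)]
        simp [stepUp]; omega
  · -- binade 7: `(132, 128)` pairs (grid units), spacing `256`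
    obtain ⟨e, he, hek⟩ : ∃ e, e < 128 * K ∧ k + 1 = 833 * K + e :=
      ⟨k + 1 - 833 * K, by omega, by omega⟩
    rcases Nat.mod_two_eq_zero_or_one e with hp | hp
    · refine value_step4 hq hR (n := (128 * K + e) * 256 + 132) ?_ (by omega) ?_
      · rw [traj4N_T7 (by omega) (by omega), hek, fam4Z_B7 K e he, pairZ_even _ _ hp]
        push_cast; omega
      · rw [traj4N_T7 (by omega) (by omega), rneSigMag_binade_step (j := 7) hM h2 (by norm_num)
          (by omega) (by norm_num)]
        simp [stepUp]; omega
    · refine value_step4 hq hR (n := (128 * K + e) * 256 + 128) ?_ (by omega) ?_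
      · rw [traj4N_T7 (by omega) (by omega), hek, fam4Z_B7 K e he, pairZ_odd _ _ hp]
        push_cast; omega
      · rw [traj4N_T7 (by omega) (by omega), rneSigMag_binade_step (j := 7) hM h2 (by norm_num)
          (by omega) (by norm_num)]
        simp [stepUp]; omega
  · -- binade 8: `(264, 256)` pairs (grid units), spacing `512`
    obtain ⟨e, he, hek⟩ : ∃ e, e < 128 * K ∧ k + 1 = 961 * K + e :=
      ⟨k + 1 - 961 * K, by omega, by omega⟩
    rcases Nat.mod_two_eq_zero_or_one e with hp | hp
    · refine value_step4 hq hR (n := (128 * K + e) * 512 + 264) ?_ (by omega) ?_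
      · rw [traj4N_T8 (by omega) (by omega), hek, fam4Z_B8 K e he, pairZ_even _ _ hp]
        push_cast; omega
      · rw [traj4N_T8 (by omega) (by omega), rneSigMag_binade_step (j := 8) hM h2 (by norm_num)
          (by omega) (by norm_num)]
        simp [stepUp]; omega
    · refine value_step4 hq hR (n := (128 * K + e) * 512 + 256) ?_ (by omega) ?_
      · rw [traj4N_T8 (by omega) (by omega), hek, fam4Z_B8 K e he, pairZ_odd _ _ hp]
        push_cast; omega
      · rw [traj4N_T8 (by omega) (by omega), rneSigMag_binade_step (j := 8) hM h2 (by norm_num)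
          (by omega) (by norm_num)]
        simp [stepUp]; omega
  · -- the end letter `528 > 512` from `128K·1024` (binade 9, spacing 1024): up to `v°`
    refine value_step4 hq hR (n := (128 * K + 0) * 1024 + 528) ?_ (by omega) ?_
    · rw [traj4N_T8 (by omega) (by omega), h, fam4Z_E]; push_cast; omega
    · rw [traj4N_F (by omega), rneSigMag_binade_step (j := 9) hM h2 (by norm_num) (by omega)
        (by norm_num)]
      simp [stepUp]; omega

/-- THE ABSORBED TAIL: at `v° = 8192K + 64` the letter `-30` gives
`v° - 30 = 128K·64 + 34`, which rounds back up to `v°` (`34` exceeds the half-spacing `32`).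
[cell, gemm.tex Thm. t:thetapmix] -/
theorem tail_fix4 :
    (roundNE φ ((8192 * (K : ℚ) + 64) + (-30))).toRat = 8192 * (K : ℚ) + 64 ∧
      |(8192 * (K : ℚ) + 64) + (-30)| ≤ φ.maxRat := by
  obtain ⟨hK1, hpow, -⟩ := pow_facts4 hM
  have h2 : 2 ∣ 128 * K := ⟨64 * K, by ring⟩
  have h := value_step4 hq hR (a := 131072 * K + 1024) (c := -480)
    (n := (128 * K + 0) * 1024 + 544) (b := 131072 * K + 1024) (by push_cast; omega) (by omega)
    (by rw [rneSigMag_binade_step (j := 9) hM h2 (by norm_num) (by omega) (by norm_num)]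
        simp [stepUp]; omega)
  have e1 : ((131072 * K + 1024 : ℕ) : ℚ) / 16 + ((-480 : ℤ) : ℚ) / 16
      = (8192 * (K : ℚ) + 64) + (-30) := by
    push_cast; ring
  have e2 : ((131072 * K + 1024 : ℕ) : ℚ) / 16 = 8192 * (K : ℚ) + 64 := by push_cast; ring
  rw [e1, e2] at h
  exact h

/-- `ŝ₀ = 16` (for `K = 1` the first letter is `2^(m+1)` itself). [cell] -/
theorem fam4_s0 : (seqSum φ (fam4 K) 0).toRat = traj4 K 0 := by
  obtain ⟨hK1, hpow, hpow1⟩ := pow_facts4 hM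
  show (roundNE φ (fam4 K 0)).toRat = traj4 K 0
  unfold fam4 traj4
  rw [fam4Z_P (by omega), traj4N_P (by omega)]
  have hr : rneSigMag φ.manBits 256 = 256 := by
    rcases Nat.lt_or_ge 256 (2 ^ (φ.manBits + 1)) with h | h
    · exact rneSigMag_of_lt h
    · have hK : K = 1 := by rw [hpow1] at h; omega
      subst hK
      have h' := rneSigMag_binade_step (t := 0) (r := 0) (j := 0) (u := 2) hM ⟨64, rfl⟩
        (by norm_num) (by norm_num) (by norm_num)
      simpa [stepUp] using h'
  have h := roundNE_grid4_nat hq hR (n := 256) (by omega)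
  rw [hr] at h
  push_cast at h ⊢
  simpa using h

/-- THE ACCUMULATOR FOLLOWS `traj4` ALONG THE WHOLE PREFIX. [cell] -/
theorem fam4_seqSum : ∀ k ≤ 1089 * K, (seqSum φ (fam4 K) k).toRat = traj4 K k := by
  intro k hk
  have h := seqSum_orbitFn (α := φ) (fam4 K) 0 (1089 * K) (fun j => fam4 K (j + 1)) (traj4 K)
    (fun j _ => by rw [Nat.zero_add]) (fam4_s0 hq hR hM)
    (fun j hj => (traj4_step hq hR hM j hj).1) k hk
  rwa [Nat.zero_add] at h

/-- The prefix stays in range. [cell] -/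
theorem fam4_inRange_prefix : InRange φ (fam4 K) (1089 * K) := by
  obtain ⟨hK1, hpow, -⟩ := pow_facts4 hM
  refine ⟨?_, fun k hk => ?_⟩
  · unfold fam4; rw [fam4Z_P (by omega), abs_of_nonneg (by positivity)]
    exact le_trans (by norm_num) (grid4_le_maxRat hR (n := 256) (by omega))
  · rw [fam4_seqSum hq hR hM k (le_of_lt hk)]
    exact (traj4_step hq hR hM k hk).2

end Steps

/-! ### The closed form for every length `n ≥ 1089K + 1` -/

section Closed

variable (hq : φ.qexp ≤ -4) (hR : (2 : ℚ) ^ (φ.manBits + 12) ≤ φ.maxRat)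
  {K : ℕ} (hM : 2 ^ φ.manBits = 128 * K)
include hq hR hM

/-- FOR EVERY `k ≥ 1089K`: `ŝₖ = 8192K + 64`, `Σ = (67008K + 528)/16 - 30(k - 1089K)`,
`Σ|·| = (67008K + 528)/16 + 30(k - 1089K)`. [cell] -/
theorem fam4_tail : ∀ k, 1089 * K ≤ k →
    (seqSum φ (fam4 K) k).toRat = 8192 * (K : ℚ) + 64 ∧
    ∑ i ∈ range (k + 1), fam4 K i
      = (67008 * (K : ℚ) + 528) / 16 + ((k : ℚ) - (1089 * K : ℕ)) * (-30) ∧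
    ∑ i ∈ range (k + 1), |fam4 K i|
      = (67008 * (K : ℚ) + 528) / 16 + ((k : ℚ) - (1089 * K : ℕ)) * 30 := by
  obtain ⟨hK1, hpow, -⟩ := pow_facts4 hM
  have hx : ∀ k, 1089 * K < k → fam4 K k = -30 := by
    intro k hk; unfold fam4; rw [fam4Z_tail (by omega)]; norm_num
  have hS : ∑ i ∈ range (1089 * K + 1), fam4 K i = (67008 * (K : ℚ) + 528) / 16 := by
    have h' : ((∑ k ∈ range (1089 * K + 1), fam4Z K k : ℤ) : ℚ)
        = ((67008 * K + 528 : ℤ) : ℚ) := by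
      rw [sum_fam4Z K]
    push_cast at h'
    unfold fam4
    simp_rw [div_eq_mul_inv]
    rw [← sum_mul, h']
  have hΛ : ∑ i ∈ range (1089 * K + 1), |fam4 K i| = (67008 * (K : ℚ) + 528) / 16 := by
    rw [← hS]
    refine sum_congr rfl (fun i hi => abs_of_pos ?_)
    unfold fam4
    have := (fam4Z_mem_pos K i).2 (by have := mem_range.mp hi; omega)
    have : (0 : ℚ) < fam4Z K i := by exact_mod_cast this
    positivity
  have hv : (seqSum φ (fam4 K) (1089 * K)).toRat = 8192 * (K : ℚ) + 64 := by
    rw [fam4_seqSum hq hR hM _ le_rfl]; unfold traj4; rw [traj4N_F le_rfl]; push_cast; ring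
  have h := tieChain_spec (α := φ) (fam4 K) (1089 * K) (-30) (8192 * (K : ℚ) + 64) _ _ hx hv
    (tail_fix4 hq hR hM).1 hS hΛ
  intro k hk
  obtain ⟨h1, h2, h3⟩ := h k hk
  refine ⟨h1, by simpa using h2, by rw [h3, abs_of_neg (by norm_num)]; push_cast; ring⟩

/-- The family never leaves the finite range of `φ`. [cell] -/
theorem fam4_inRange : ∀ k, InRange φ (fam4 K) k := by
  refine tieChain_inRange (α := φ) (fam4 K) (1089 * K) (-30) (8192 * (K : ℚ) + 64)
    (fun k hk => by unfold fam4; rw [fam4Z_tail (by omega)]; norm_num) ?_ (tail_fix4 hq hR hM).1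
    (fam4_inRange_prefix hq hR hM) (tail_fix4 hq hR hM).2
  rw [fam4_seqSum hq hR hM _ le_rfl]; unfold traj4; rw [traj4N_F le_rfl]; push_cast; ring

/-- THE CLOSED FORM: for every length `n = k + 1 ≥ 1089K + 1` the relative error of the family is
`(30n - 28666K + 1)/(30n - 28482K + 3)`. [cell, gemm.tex Thm. t:thetapmix] -/
theorem fam4_relErr (k : ℕ) (hk : 1089 * K ≤ k) :
    |(seqSum φ (fam4 K) k).toRat - ∑ i ∈ range (k + 1), fam4 K i|
        / ∑ i ∈ range (k + 1), |fam4 K i|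
      = (30 * ((k : ℚ) + 1) - 28666 * K + 1) / (30 * ((k : ℚ) + 1) - 28482 * K + 3) := by
  obtain ⟨h1, h2, h3⟩ := fam4_tail hq hR hM k hk
  have hk' : ((1089 * K : ℕ) : ℚ) ≤ k := by exact_mod_cast hk
  have hK0 : (0 : ℚ) ≤ K := Nat.cast_nonneg K
  rw [h1, h2, h3]
  push_cast at hk' ⊢
  have hd1 : (0 : ℚ) < (67008 * (K : ℚ) + 528) / 16 + ((k : ℚ) - 1089 * (K : ℚ)) * 30 := by
    nlinarith
  have hd2 : (0 : ℚ) < 30 * ((k : ℚ) + 1) - 28482 * K + 3 := by nlinarith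
  rw [abs_of_nonneg (by nlinarith), div_eq_div_iff hd1.ne' hd2.ne']
  ring

/-- Equivalently `1 - (relative error) = (184K + 2)/(30n - 28482K + 3)` — the numerator is
`30·θ_p`. [cell, gemm.tex Thm. t:thetapmix] -/
theorem fam4_defect (k : ℕ) (hk : 1089 * K ≤ k) :
    1 - |(seqSum φ (fam4 K) k).toRat - ∑ i ∈ range (k + 1), fam4 K i|
        / ∑ i ∈ range (k + 1), |fam4 K i|
      = (184 * (K : ℚ) + 2) / (30 * ((k : ℚ) + 1) - 28482 * K + 3) := by
  rw [fam4_relErr hq hR hM k hk]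
  have hk' : ((1089 * K : ℕ) : ℚ) ≤ k := by exact_mod_cast hk
  push_cast at hk'
  have hden : (30 * ((k : ℚ) + 1) - 28482 * K + 3) ≠ 0 := by
    have : (0 : ℚ) ≤ K := Nat.cast_nonneg K
    exact (by nlinarith : (0 : ℚ) < 30 * ((k : ℚ) + 1) - 28482 * K + 3).ne'
  rw [eq_div_iff hden, sub_mul, div_mul_cancel₀ _ hden]
  ring

end Closed

end Summit.Ventures.CertifiedArithmetic.LowPrec.Gemm
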